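import Summits.BirchSwinnertonDyer.BirchSwinnertonDyer.Theorems.SignedLowerHalvesSmallImageLowerHalfBothSignsRttCharRoadE2JunctionLocalCount
import Summits.BirchSwinnertonDyer.BirchSwinnertonDyer.Theorems.SignedLowerHalvesSmallImageLowerHalfBothSignsRttCharRoadE2JunctionMonotone
import Summits.BirchSwinnertonDyer.BirchSwinnertonDyer.Theorems.ByReductionTypeAtTwoOrdKatoHalfIsogenyMu
import Literature.NumberTheory.EllipticCurves.IwasawaOrderKernelRankProofs
import Mathlib.LinearAlgebra.TensorProduct.Pi
import HarnessLib

/-!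
# Route `SignedLowerHalves`, crux L `SmallImageLowerHalfBothSigns` (stmt-BirchSwinnertonDyer-23599), line `rtt_w3` v30 — stub S3β″ (`stub_junctionPT_ns`), input N5-(iii)
# (the local count `λ(Λ_𝒪/(E)) ≤ λ(H′)`), GENERIC HALF: `λ` OF A FINITE PRODUCT IS THE SUM, and `λ(Λ_𝒪 ⧸ (C(p^d)·∏_{w∈T} P_w)) ≤ λ(H′)` AS SOON AS EACH `Λ_𝒪/(P_w)` EMBEDS INTO
# THE `w`-COMPONENT OF `H′ ≤ Π_{w∈S₀} M_w`

WIDTH seat `bsd-line-slh-p3-w3` g26 under LEAD `cruxlead-stmt-BirchSwinnertonDyer-23599` g14 (cell `bsd-ssimc`); helper `--supports stmt-BirchSwinnertonDyer-23599`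
(design memo `Lines/rtt_w3-DESIGN-S3beta-w3-g25.md`, rev 4 §6 RECIPE N5). THEOREMS ONLY (no definition, no named fact, no instance, no `sorry`). HONEST FRAMING: this is the GENERIC half of
N5-(iii); the ARITHMETIC half — for each `w ∈ T = S₀K ∖ supp(p𝔣)` an INJECTIVE `Λ_𝒪`-linear `Λ_𝒪/(P_w) ↪ 𝐇¹_{Iw,w}` with unramified image (the unramified generator `u_w`, compatible
family of the classes `Frob_w ↦ δ_{1·U_n} ⊗ ξ_k`, `Ann(u_w) = (P_w)`: honda (L1) germ p805939 gives `(P_w) ⊆ Ann`, the explicit structure `H¹_ur(K_w, Maps(Γ_K⧸U_n, X_k)) ≅ Λ_𝒪/(p^k, ω_n, P_w)`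
gives `⊇`) — is NOT proved here and is the displayed hypothesis `g`/`hg`/`hmem`. With it, T5 (p812244), N2 (p816516/p816550/p816760), `…RttD2SeqSemilocAssembly` (p816814) and N5-(i)
(`…RttD2SeqSemilocNakayama`, p817289) the LEAD's S3β″ is `strictDual_add_le_coker_add_of_le_locImageDual_add ∘ le_trans (this file) (lambdaInvariant_unramifiedFamilies_le)`.
Nothing about S3β″, crux L or BSD is proved; all remain OPEN and are proved for NO curve.

* §1 ★ `lambdaInvariant_pi_eq_sum` — `λ(Π_{i} M_i) = Σ_i λ(M_i)` for finitely many finitely generated torsion `Λ`-modules (`ℚ_p ⊗ Π ≅ Π ℚ_p ⊗`, `IwasawaAlgebra.finite_baseChange_of_isTorsion`).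
* §2 ★★ `lambdaInvariant_quotient_span_C_pow_mul_prod_le_of_injective` — `λ(Λ_𝒪 ⧸ (C(p^d) ∏_{w∈T} P_w)) ≤ λ(H′)` from ONE injective `Λ_𝒪`-linear `Π_{w:T} Λ_𝒪/(P_w) → H′`
  (`P_w ≠ 0`; LEAD g11 `lambdaInvariant_quotient_span_singleton_mul/_prod`, `λ(Λ_𝒪/(C p^d)) = 0`, §1, λ-monotonicity `lambdaInvariant_le_of_injective_of_isTorsion_restrictScalars`).
* §3 ★★★ `lambdaInvariant_quotient_span_le_of_single_mem` — the SHAPE S3β″ consumes: `H′` a `Λ_𝒪`-submodule of `Π_{w:S₀} M_w` (intended `M_w = (L w).H`, `H′ = unramifiedFamilies`),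
  `T ⊆ S₀` finite, per-place injective `g_w : Λ_𝒪/(P_w) →ₗ[Λ_𝒪] M_w` whose values, placed in the `w`-component, lie in `H′` ⟹ `λ(Λ_𝒪/(C(p^d)∏_{w∈T} P_w)) ≤ λ(H′)`.
References: [Washington1997] §13.2; [GreenbergVatsal2000] §2 Prop. (2.4); [PerrinRiou1994Invent] §1.3; [Rubin2000] Thm. 1.7.3, App. B.3.
-/

set_option autoImplicit false
set_option linter.dupNamespace false -- D-0017: single-problem summit, the namespace repeats the problem name by design
noncomputable section

open scoped Classical TensorProduct

namespace Summit.BirchSwinnertonDyer.BirchSwinnertonDyer.Theorems.SmallImageRttD2Seq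

open Literature.NumberTheory.EllipticCurves Literature.NumberTheory.EllipticCurves.IwasawaDual
  Summit.BirchSwinnertonDyer.BirchSwinnertonDyer.Theorems.SmallImageRttCharRoad

universe u v

/-! ## §1. `λ` of a finite product -/

section Pi

variable {p : ℕ} [Fact p.Prime]

/-- ★ **`λ(Π_i M_i) = Σ_i λ(M_i)`** for finitely many finitely generated torsion `Λ`-modules: `ℚ_p ⊗_{ℤ_p} Π_i M_i ≅ Π_i ℚ_p ⊗_{ℤ_p} M_i` (`TensorProduct.piRight`), each factor
finite-dimensional (`IwasawaAlgebra.finite_baseChange_of_isTorsion`), and `dim` is additive on finite products. [cite: Washington1997, §13.2] [folklore] -/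
theorem lambdaInvariant_pi_eq_sum {ι : Type u} [Fintype ι] (M : ι → Type v) [∀ i, AddCommGroup (M i)] [∀ i, Module (IwasawaAlgebra p) (M i)]
    [∀ i, Module.Finite (IwasawaAlgebra p) (M i)] (h : ∀ i, Module.IsTorsion (IwasawaAlgebra p) (M i)) :
    lambdaInvariant p (∀ i, M i) = ∑ i, lambdaInvariant p (M i) := by
  letI : ∀ i, Module ℤ_[p] (M i) := fun i ↦ Module.compHom (M i) (algebraMap ℤ_[p] (IwasawaAlgebra p))
  haveI : ∀ i, IsScalarTower ℤ_[p] (IwasawaAlgebra p) (M i) := fun i ↦ IsScalarTower.of_compHom _ _ _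
  haveI : ∀ i, Module.Finite ℚ_[p] (ℚ_[p] ⊗[ℤ_[p]] M i) := fun i ↦ IwasawaAlgebra.finite_baseChange_of_isTorsion p (h i)
  change Module.finrank ℚ_[p] (ℚ_[p] ⊗[ℤ_[p]] (∀ i, M i)) = ∑ i, Module.finrank ℚ_[p] (ℚ_[p] ⊗[ℤ_[p]] M i)
  rw [LinearEquiv.finrank_eq (TensorProduct.piRight ℤ_[p] ℚ_[p] ℚ_[p] M), Module.finrank_pi_fintype]

end Pi

/-! ## §2. The local count from one injection -/

section Count

variable {p : ℕ} [Fact p.Prime] {S : Set (PadicAlgCl p)} [FiniteDimensional ℚ_[p] (padicCoeffField S)] [Algebra (IwasawaAlgebra p) (IwasawaAlgebraO S)]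
  (halg : ∀ r : IwasawaAlgebra p, algebraMap (IwasawaAlgebra p) (IwasawaAlgebraO S) r = iwasawaToIwasawaO S r)

omit [FiniteDimensional ℚ_[p] (padicCoeffField S)] in
/-- **`λ(Λ_𝒪 ⧸ (C(p^d))) = 0`**: the quotient is killed by the integer `p^d`. [cite: Washington1997, §13.2] [folklore] -/
theorem lambdaInvariant_quotient_span_C_pow_eq_zero (d : ℕ) :
    lambdaInvariant p (IwasawaAlgebraO S ⧸ Ideal.span {PowerSeries.C ((p : padicCoeffIntegers S) ^ d)}) = 0 := by
  refine KatoHalfIsogeny.lambdaInvariant_eq_zero_of_nsmul_eq_zero p (n := p ^ d) (pow_ne_zero _ (Fact.out : p.Prime).ne_zero) fun x ↦ ?_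
  obtain ⟨a, rfl⟩ := Submodule.Quotient.mk_surjective _ x
  rw [← Nat.cast_smul_eq_nsmul (IwasawaAlgebraO S), ← Submodule.Quotient.mk_smul, Submodule.Quotient.mk_eq_zero, smul_eq_mul]
  refine Ideal.mem_span_singleton'.mpr ⟨a, ?_⟩
  rw [mul_comm, ← map_natCast (PowerSeries.C (R := padicCoeffIntegers S)), Nat.cast_pow]

include halg in
/-- ★★ **THE LOCAL COUNT FROM ONE INJECTION**: for non-zero `P_w ∈ Λ_𝒪` (`w ∈ T` finite), `d ∈ ℕ`, and a finitely generated torsion `Λ`-module `H′` (with its `Λ_𝒪`-structure in tower),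
an INJECTIVE `Λ_𝒪`-linear `u : Π_{w:T} Λ_𝒪/(P_w) → H′` gives `λ(Λ_𝒪 ⧸ (C(p^d) · ∏_{w∈T} P_w)) ≤ λ(H′)`
(`λ(Λ_𝒪/(C p^d ∏ P_w)) = 0 + Σ_w λ(Λ_𝒪/(P_w)) = λ(Π_w Λ_𝒪/(P_w)) ≤ λ(H′)`). [cite: Washington1997, §13.2] [cite: GreenbergVatsal2000, §2 Prop. (2.4)] [cite: PerrinRiou1994Invent, §1.3] -/
theorem lambdaInvariant_quotient_span_C_pow_mul_prod_le_of_injective {ι' : Type u} (T : Finset ι') (P : ι' → IwasawaAlgebraO S) (hP : ∀ w ∈ T, P w ≠ 0) (d : ℕ)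
    {H' : Type v} [AddCommGroup H'] [Module (IwasawaAlgebraO S) H'] [Module (IwasawaAlgebra p) H'] [IsScalarTower (IwasawaAlgebra p) (IwasawaAlgebraO S) H']
    [Module.Finite (IwasawaAlgebra p) H'] (hH' : Module.IsTorsion (IwasawaAlgebra p) H')
    (u : (∀ w : T, IwasawaAlgebraO S ⧸ Ideal.span {P w}) →ₗ[IwasawaAlgebraO S] H') (hu : Function.Injective u) :
    lambdaInvariant p (IwasawaAlgebraO S ⧸ Ideal.span {PowerSeries.C ((p : padicCoeffIntegers S) ^ d) * ∏ w ∈ T, P w}) ≤ lambdaInvariant p H' := by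
  have hC : (PowerSeries.C ((p : padicCoeffIntegers S) ^ d) : IwasawaAlgebraO S) ≠ 0 := by
    rw [Ne, ← map_zero (PowerSeries.C (R := padicCoeffIntegers S)), PowerSeries.C_injective.eq_iff]
    exact pow_ne_zero _ (by exact_mod_cast (Fact.out : p.Prime).ne_zero)
  have hprod : ∏ w ∈ T, P w ≠ 0 := Finset.prod_ne_zero_iff.mpr hP
  haveI : ∀ w : T, Module.Finite (IwasawaAlgebra p) (IwasawaAlgebraO S ⧸ Ideal.span {P w}) := fun w ↦ moduleFinite_iwasawaAlgebraO_quotient_span_singleton S halg (P w)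
  have htors : ∀ w : T, Module.IsTorsion (IwasawaAlgebra p) (IwasawaAlgebraO S ⧸ Ideal.span {P w}) := fun w ↦ isTorsion_iwasawaAlgebraO_quotient_span_singleton S halg (hP w w.2)
  rw [lambdaInvariant_quotient_span_singleton_mul halg hC hprod, lambdaInvariant_quotient_span_C_pow_eq_zero, zero_add,
    lambdaInvariant_quotient_span_singleton_prod halg T P hP, ← Finset.sum_coe_sort, ← lambdaInvariant_pi_eq_sum _ htors]
  exact lambdaInvariant_le_of_injective_of_isTorsion_restrictScalars u hu hH'

include halg in
/-- ★★★ **THE LOCAL COUNT IN THE SHAPE S3β″ CONSUMES.** Let `H′` be a `Λ_𝒪`-submodule of `Π_{w:S₀} M_w` (intended: `M_w = (L w).H = 𝐇¹_{Iw,w}`, `H′ = unramifiedFamilies …`), finitely generated and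
torsion over `Λ`; `T ⊆ S₀` finite; for each `w ∈ T` a non-zero `P_w ∈ Λ_𝒪` and an INJECTIVE `Λ_𝒪`-linear `g_w : Λ_𝒪/(P_w) → M_w` (intended: `f ↦ f · u_w`, `u_w` the unramified generator,
`Ann(u_w) = (P_w)`) whose values placed in the `w`-component lie in `H′`. Then `λ(Λ_𝒪 ⧸ (C(p^d) · ∏_{w∈T} P_w)) ≤ λ(H′)` — with `P_w = ι((1+T)^{x_w}) − C(θ′(φ_w)χ_cyc(φ_w))` the left side is
`λ(Λ_𝒪 ⧸ (JunctionDepletion S θ′ T φ x d))`. [cite: Washington1997, §13.2] [cite: GreenbergVatsal2000, §2 Prop. (2.4)] [cite: PerrinRiou1994Invent, §1.3] [cite: Rubin2000, Thm. 1.7.3, App. B.3] -/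
theorem lambdaInvariant_quotient_span_le_of_single_mem {ι' : Type u} (S₀ : Set ι') (T : Finset ι') (hTS : ∀ w ∈ T, w ∈ S₀)
    (P : ι' → IwasawaAlgebraO S) (hP : ∀ w ∈ T, P w ≠ 0) (d : ℕ)
    (M : ι' → Type v) [∀ w, AddCommGroup (M w)] [∀ w, Module (IwasawaAlgebraO S) (M w)] [∀ w, Module (IwasawaAlgebra p) (M w)]
    [∀ w, IsScalarTower (IwasawaAlgebra p) (IwasawaAlgebraO S) (M w)]
    (H' : Submodule (IwasawaAlgebraO S) (∀ w : S₀, M w)) [Module.Finite (IwasawaAlgebra p) H'] (hH' : Module.IsTorsion (IwasawaAlgebra p) H')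
    (g : ∀ w : ι', (IwasawaAlgebraO S ⧸ Ideal.span {P w}) →ₗ[IwasawaAlgebraO S] M w) (hg : ∀ w ∈ T, Function.Injective (g w))
    (hmem : ∀ (w : ι') (hw : w ∈ T) (b : IwasawaAlgebraO S ⧸ Ideal.span {P w}), Pi.single (M := fun v : S₀ ↦ M v) ⟨w, hTS w hw⟩ (g w b) ∈ H') :
    lambdaInvariant p (IwasawaAlgebraO S ⧸ Ideal.span {PowerSeries.C ((p : padicCoeffIntegers S) ^ d) * ∏ w ∈ T, P w}) ≤ lambdaInvariant p H' := by
  -- the block map `Π_{w:T} Λ_𝒪/(P_w) → Π_{w:S₀} M_w`, `a ↦ Σ_w single_w (g_w (a w))`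
  let U : (∀ w : T, IwasawaAlgebraO S ⧸ Ideal.span {P w}) →ₗ[IwasawaAlgebraO S] (∀ v : S₀, M v) :=
    ∑ w : T, (LinearMap.single (IwasawaAlgebraO S) (fun v : S₀ ↦ M v) ⟨w, hTS w w.2⟩).comp ((g w).comp (LinearMap.proj w))
  have hU_apply : ∀ a, U a = ∑ w : T, Pi.single (M := fun v : S₀ ↦ M v) ⟨w, hTS w w.2⟩ (g w (a w)) := fun a ↦ by
    simp only [U, LinearMap.coe_sum, Finset.sum_apply, LinearMap.coe_comp, Function.comp_apply, LinearMap.coe_proj, Function.eval,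
      LinearMap.coe_single]
  have hU_mem : ∀ a, U a ∈ H' := fun a ↦ by
    rw [hU_apply]
    exact H'.sum_mem fun w _ ↦ hmem w w.2 (a w)
  -- evaluation at the `w`-component recovers `g_w (a w)`
  have hU_eval : ∀ (a) (w : T), U a ⟨w, hTS w w.2⟩ = g w (a w) := fun a w ↦ by
    rw [hU_apply, Finset.sum_apply, Finset.sum_eq_single w]
    · rw [Pi.single_eq_same]
    · intro w' _ hw'
      rw [Pi.single_eq_of_ne]
      intro h
      have h' : (w : ι') = (w' : ι') := congrArg (fun v : S₀ ↦ (v : ι')) h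
      exact hw' (Subtype.ext h').symm
    · intro h; exact absurd (Finset.mem_univ w) h
  refine lambdaInvariant_quotient_span_C_pow_mul_prod_le_of_injective halg T P hP d hH' (LinearMap.codRestrict H' U hU_mem) fun a b hab ↦ ?_
  have hab' : U a = U b := congrArg Subtype.val hab
  funext w
  apply hg w w.2
  rw [← hU_eval a w, ← hU_eval b w, hab']

end Count

end Summit.BirchSwinnertonDyer.BirchSwinnertonDyer.Theorems.SmallImageRttD2Seq

end
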